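import Literature.NumberTheory.Automorphic.SupercuspidalTwoPlaceNonvanishing
import Literature.NumberTheory.Automorphic.CompactSubgroupVectorAveraging
import Literature.NumberTheory.Automorphic.LocalComponentDensity
import Literature.NumberTheory.Automorphic.SupercuspidalTestFunctions
import Literature.NumberTheory.Automorphic.UnipotentAveragesLocalPlace
import Literature.NumberTheory.Automorphic.AdicCompletionLocalField
import HarnessLib

/-!
# Two supercuspidal local components: a test function `θ ⊗ ξ₁ ⊗ ξ₂` of supercusp type at two
# places which does not kill an irreducible `Π`
(Gelbart, *Automorphic forms on adele groups* (1975), §10, pp. 151–153 with Cor. 9.24: supercusp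
forms at (at least) two places and `R₀^ψ(Φ_f)|_π ≠ 0`; Jacquet–Langlands, LNM 114 (1970), §16,
pp. 503–504)

Topic `NumberTheory/Automorphic`; theorems only (no definition, no named fact, no instance
visible to importers). Assembly of `SupercuspidalTwoPlaceNonvanishing` (the two-place Hecke
calculus and non-vanishing on a doubly smooth vector with non-zero double Hecke sum),
`CompactSubgroupVectorAveraging` (the idempotents `P_{ι_v(U_m)}`), `LocalComponentDensity`
(translates away from `w` of a local component are dense in an irreducible `Π`) and
`SupercuspidalTestFunctions` (supercusp forms from smooth linear forms, with levels), WITHOUT the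
restricted tensor product theorem:

* `mulStar_supercuspForm` — if `ξ` is a supercusp form (vanishing unipotent averages for every
  additive Haar measure) then so is `ξ^*(g) = \overline{ξ(g⁻¹)}` (the Haar measure transported by
  `Y ↦ -Y` is again a Haar measure);
* `integral_localTestFunction₂_comp_glUnipotent_eq_zero` — `θ ⊗ ξ₁ ⊗ ξ₂` satisfies `(H_k)` as soon
  as `ξ₁` is a supercusp form at `v₁` (`integral_comp_glUnipotent_eq_zero_of_place`);
* `exists_localTestFunction₂_of_two_supercuspidal_localComponents` — **for a topologically
  irreducible closed `Π ≤ L²(GL_n(K) A_G \ GL_n(𝔸_K))` with irreducible smooth supercuspidal local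
  components `ρ₁` at `v₁` and `ρ₂` at `v₂ ≠ v₁` there are supercusp forms `ξ₁`, `ξ₂` and a
  neighbourhood `N` of `1` such that `R(θ ⊗ ξ₁ ⊗ ξ₂) y ≠ 0` for some `y ∈ Π`, for every continuous
  compactly supported `θ ≥ 0` with `θ(1) > 0` supported in `N`.** Construction: move the local
  component map `F₁` at `v₁` into the `ι₂(U_m)`-fixed vectors by `P_{ι₂(U_m)}` (which commutes with
  `ι₁(GL_n(K_{v₁}))`), take `ξ₁` from `exists_supercuspTestFunction_invariant` and
  `y = Σ ξ₁(γ̃₁) R(ι₁ γ̃₁) z = F°(h₁) ≠ 0`; pair `y` with a translate `R(g) F₂(x₂)`, `g_{v₂} = 1`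
  (`exists_inner_translate_localComponent_ne_zero`), which makes `x ↦ ⟪y, R(g) F₂ x⟫` a smooth
  linear form of `ρ₂`; take `ξ₂ = ξ₀^*` for the supercusp form `ξ₀` of
  `exists_supercuspTestFunction_of_mem_contragredient_left`; the double Hecke sum paired with
  `R(g) F₂(x₂)` is a sum of non-negative reals with a positive term.

## References

* S. Gelbart, *Automorphic forms on adele groups*, Ann. of Math. Studies 83 (1975), §10,
  pp. 151–153, Cor. 9.24 [Gelbart1975].
* H. Jacquet, R. P. Langlands, *Automorphic forms on `GL(2)`*, LNM 114 (1970), §16, pp. 503–504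
  [JacquetLanglands1970].
-/

noncomputable section

open MeasureTheory Measure Set Filter Topology IsDedekindDomain NumberField CompactlySupported
open scoped Pointwise InnerProductSpace ComplexConjugate

namespace Literature.NumberTheory.Automorphic

/-! ### `ξ^*` of a supercusp form is a supercusp form -/

section MulStar

variable {F : Type*} [Field F] [TopologicalSpace F] [IsTopologicalRing F] {n k : ℕ}

/-- If `∫ f dα = 0` for **every** additive Haar measure `α` on a commutative additive group then
also `∫ f(-Y) dα(Y) = 0` (the image of `α` under `Y ↦ -Y` is an additive Haar measure).
[folklore] -/
theorem integral_comp_neg_eq_zero_of_forall {G : Type*} [AddCommGroup G] [TopologicalSpace G]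
    [IsTopologicalAddGroup G] [MeasurableSpace G] [BorelSpace G] {E : Type*} [NormedAddCommGroup E]
    [NormedSpace ℝ E] {f : G → E}
    (h : ∀ (α : Measure G) [α.IsAddHaarMeasure], ∫ x, f x ∂α = 0)
    (α : Measure G) [α.IsAddHaarMeasure] : ∫ x, f (-x) ∂α = 0 := by
  haveI : (Measure.map (⇑(MeasurableEquiv.neg G)) α).IsAddHaarMeasure :=
    AddEquiv.isAddHaarMeasure_map α (AddEquiv.neg G) continuous_neg continuous_neg
  have h1 := h (Measure.map (⇑(MeasurableEquiv.neg G)) α)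
  rw [integral_map_equiv] at h1
  exact h1

/-- **`ξ^*(g) = \overline{ξ(g⁻¹)}` is a supercusp form if `ξ` is**: for all `a, b` and every
additive Haar measure, `∫ ξ^*(a (1 + Y) b) dY = \overline{∫ ξ(b⁻¹ (1 - Y) a⁻¹) dY} = 0`
(`(1 + Y)⁻¹ = 1 + (-Y)` along the one-parameter unipotent subgroup, and `Y ↦ -Y` preserves the
class of Haar measures). [folklore] -/
theorem mulStar_supercuspForm [MeasurableSpace (blockNilpotent n k F)] [BorelSpace (blockNilpotent n k F)]
    {ξ : GL (Fin n) F → ℂ}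
    (hξ0 : ∀ (α : Measure (blockNilpotent n k F)) [α.IsAddHaarMeasure] (a b : GL (Fin n) F),
      ∫ Y, ξ (a * unipotentOfBlock n k F (Multiplicative.ofAdd Y) * b) ∂α = 0)
    (α : Measure (blockNilpotent n k F)) [α.IsAddHaarMeasure] (a b : GL (Fin n) F) :
    ∫ Y, mulStar ξ (a * unipotentOfBlock n k F (Multiplicative.ofAdd Y) * b) ∂α = 0 := by
  simp only [mulStar]
  rw [integral_conj]
  have h1 : (fun Y : blockNilpotent n k F =>
      ξ (a * unipotentOfBlock n k F (Multiplicative.ofAdd Y) * b)⁻¹) =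
      fun Y => ξ (b⁻¹ * unipotentOfBlock n k F (Multiplicative.ofAdd (-Y)) * a⁻¹) := by
    funext Y
    rw [mul_inv_rev, mul_inv_rev, ← map_inv, ofAdd_neg, mul_assoc]
  rw [h1, integral_comp_neg_eq_zero_of_forall (fun β _ => hξ0 β b⁻¹ a⁻¹) α, map_zero]

end MulStar

/-! ### `θ ⊗ ξ₁ ⊗ ξ₂` is of supercusp type when `ξ₁` is a supercusp form -/

section SupercuspType₂

variable {n k : ℕ} {K : Type} [Field K] [NumberField K] {v₁ v₂ : HeightOneSpectrum (𝓞 K)}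

/-- `Φ(p ι₁(u) r) = θ(s₂ s₁ p · s₂ s₁ r) ξ₂(p_{v₂} r_{v₂}) · ξ₁(p_{v₁} u r_{v₁})` for the two-place
product function (`s₁`, `s₂` are homomorphisms, `s₁ ∘ ι₁ = 1`, `(ι₁ u)_{v₂} = 1`). [folklore] -/
theorem localTestFunction₂_mul_toAdelic_mul (h : v₁ ≠ v₂) (θ : (AdelicGroupData.gl n K).Adelic → ℝ)
    (ξ₁ : GL (Fin n) (v₁.adicCompletion K) → ℂ) (ξ₂ : GL (Fin n) (v₂.adicCompletion K) → ℂ)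
    (p r : (AdelicGroupData.gl n K).Adelic) (u : GL (Fin n) (v₁.adicCompletion K)) :
    localTestFunction₂ v₁ v₂ θ ξ₁ ξ₂ (p * GLn.toAdelic n K v₁ u * r) =
      ((θ (GLn.awayFrom n K v₂ (GLn.awayFrom n K v₁ p) * GLn.awayFrom n K v₂ (GLn.awayFrom n K v₁ r)) : ℂ) *
        ξ₂ (GLn.toLocalAt n K v₂ p * GLn.toLocalAt n K v₂ r)) *
        ξ₁ (GLn.toLocalAt n K v₁ p * u * GLn.toLocalAt n K v₁ r) := by
  simp only [localTestFunction₂, GLn.awayFrom_mul, GLn.awayFrom_toAdelic, mul_one,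
    map_mul, GLn.toLocal_toAdelic, GLn.toLocalAt_toAdelic_of_ne h]
  ring

/-- **`θ ⊗ ξ₁ ⊗ ξ₂` satisfies `(H_k)` when `ξ₁` is a supercusp form at `v₁`**: vanishing of
`∫_{𝔫_k(K_{v₁})} ξ₁(a (1 + Y) b) dY` for all `a, b` (some Borel structure and additive Haar measure)
implies `∫_{𝔫_k(𝔸_K)} Φ(p (1 + Y) r) dY = 0` for all `p, r` and every additive Haar measure
(`integral_comp_glUnipotent_eq_zero_of_place`). [cite: JacquetLanglands1970, §16 p. 503] -/
theorem integral_localTestFunction₂_comp_glUnipotent_eq_zero (h : v₁ ≠ v₂)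
    {θ : (AdelicGroupData.gl n K).Adelic → ℝ} (hθ : Continuous θ) (hθs : HasCompactSupport θ)
    {ξ₁ : GL (Fin n) (v₁.adicCompletion K) → ℂ} (hξ₁ : Continuous ξ₁) (hξ₁s : HasCompactSupport ξ₁)
    {ξ₂ : GL (Fin n) (v₂.adicCompletion K) → ℂ} (hξ₂ : Continuous ξ₂) (hξ₂s : HasCompactSupport ξ₂)
    [MeasurableSpace (blockNilpotent n k (v₁.adicCompletion K))]
    [BorelSpace (blockNilpotent n k (v₁.adicCompletion K))]
    (αw : Measure (blockNilpotent n k (v₁.adicCompletion K))) [αw.IsAddHaarMeasure]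
    (hξ0 : ∀ a b : GL (Fin n) (v₁.adicCompletion K),
      ∫ Y, ξ₁ (a * unipotentOfBlock n k (v₁.adicCompletion K) (Multiplicative.ofAdd Y) * b) ∂αw = 0)
    (ν : Measure (blockNilpotent n k (AdeleRing (𝓞 K) K))) [ν.IsAddHaarMeasure]
    (p r : (AdelicGroupData.gl n K).Adelic) :
    ∫ Y, localTestFunction₂ v₁ v₂ θ ξ₁ ξ₂ (p * glUnipotent n k K (Multiplicative.ofAdd Y) * r) ∂ν = 0 := by
  refine integral_comp_glUnipotent_eq_zero_of_place v₁ (GLn.toAdelic n K v₁) (fun _ => rfl)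
    (continuous_localTestFunction₂ hθ hξ₁ hξ₂) (hasCompactSupport_localTestFunction₂ h hθs hξ₁s hξ₂s)
    αw (fun p r => ?_) ν p r
  simp_rw [localTestFunction₂_mul_toAdelic_mul h]
  rw [integral_const_mul, hξ0, mul_zero]

end SupercuspType₂

/-! ### Two supercuspidal local components of an irreducible `Π` -/

section Assembly

variable {n : ℕ} {K : Type} [Field K] [NumberField K] {v₁ v₂ : HeightOneSpectrum (𝓞 K)}
  {μ : Measure (AdelicGroupData.gl n K).automorphicQuotient}
  [(AdelicGroupData.gl n K).IsAutomorphicMeasure μ]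

attribute [local instance] adelicBorel borelSpace_adelic locallyCompactSpace_adelic
  secondCountableTopology_gl_adelic

/-- A Borel structure and a Haar measure on `GL_n(K_v)` exist (locally compact Hausdorff group;
packaged as an existential so that no instance escapes). [folklore] -/
theorem exists_haarMeasure_glLocal (v : HeightOneSpectrum (𝓞 K)) :
    ∃ (_ : MeasurableSpace (GL (Fin n) (v.adicCompletion K)))
      (_ : BorelSpace (GL (Fin n) (v.adicCompletion K))) (μv : Measure (GL (Fin n) (v.adicCompletion K))),
      μv.IsHaarMeasure := by
  haveI : T2Space (Matrix (Fin n) (Fin n) (v.adicCompletion K)) :=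
    inferInstanceAs (T2Space (Fin n → Fin n → v.adicCompletion K))
  haveI : LocallyCompactSpace (Matrix (Fin n) (Fin n) (v.adicCompletion K)) :=
    inferInstanceAs (LocallyCompactSpace (Fin n → Fin n → v.adicCompletion K))
  haveI : LocallyCompactSpace (GL (Fin n) (v.adicCompletion K)) := inferInstance
  letI : MeasurableSpace (GL (Fin n) (v.adicCompletion K)) := borel _
  haveI : BorelSpace (GL (Fin n) (v.adicCompletion K)) := ⟨rfl⟩
  exact ⟨inferInstance, inferInstance, Measure.haar, inferInstance⟩

/-- **Two supercuspidal local components** (Gelbart (1975), §10, pp. 151–153 with Cor. 9.24;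
Jacquet–Langlands (1970), §16, pp. 503–504). Let `Π ≤ L²(GL_n(K) A_G \\ GL_n(𝔸_K))` (`0 < n`) be
closed and topologically irreducible, with local components `ρ₁` at `v₁` and `ρ₂` at `v₂ ≠ v₁`
(`HasLocalComponentAt`), `ρ₁` irreducible smooth supercuspidal and `ρ₂` smooth supercuspidal.
There are supercusp forms `ξ₁ ∈ C_c(GL_n(K_{v₁}))`, `ξ₂ ∈ C_c(GL_n(K_{v₂}))` (vanishing
unipotent averages for every Borel structure and additive Haar measure) and a neighbourhood `N` of
`1` in `GL_n(𝔸_K)` such that for every continuous compactly supported weight `θ ≥ 0` with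
`θ(1) > 0` supported in `N`, the operator `R(θ^{(v₁v₂)} ⊗ ξ₁ ⊗ ξ₂)` is non-zero on some `y ∈ Π`
— the test function being of supercusp type at both places
(`integral_localTestFunction₂_comp_glUnipotent_eq_zero`, `mulStar_supercuspForm`).
[cite: Gelbart1975, §10 pp. 151–153] -/
theorem exists_localTestFunction₂_of_two_supercuspidal_localComponents (hn : 0 < n) (h : v₁ ≠ v₂)
    (W : ContRepresentation.ClosedSubrep ((AdelicGroupData.gl n K).rightRegular μ))
    (hirr : W.toContRep.IsTopIrreducible)
    {V₁ : Type*} [AddCommGroup V₁] [Module ℂ V₁]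
    {ρ₁ : Representation ℂ (GL (Fin n) (v₁.adicCompletion K)) V₁}
    (hρ₁ : ρ₁.IsIrreducible) (hρ₁s : ρ₁.IsSmooth) (hρ₁c : ρ₁.IsSupercuspidal)
    (hW₁ : HasLocalComponentAt W v₁ ρ₁)
    {V₂ : Type*} [AddCommGroup V₂] [Module ℂ V₂]
    {ρ₂ : Representation ℂ (GL (Fin n) (v₂.adicCompletion K)) V₂}
    (hρ₂s : ρ₂.IsSmooth) (hρ₂c : ρ₂.IsSupercuspidal) (hW₂ : HasLocalComponentAt W v₂ ρ₂) :
    ∃ (ξ₁ : C_c(GL (Fin n) (v₁.adicCompletion K), ℂ)) (ξ₂ : C_c(GL (Fin n) (v₂.adicCompletion K), ℂ)),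
      (∀ k, 0 < k → k < n → ∀ [MeasurableSpace (blockNilpotent n k (v₁.adicCompletion K))]
        [BorelSpace (blockNilpotent n k (v₁.adicCompletion K))]
        (α : Measure (blockNilpotent n k (v₁.adicCompletion K))) [α.IsAddHaarMeasure]
        (a b : GL (Fin n) (v₁.adicCompletion K)),
        ∫ Y, ξ₁ (a * unipotentOfBlock n k (v₁.adicCompletion K) (Multiplicative.ofAdd Y) * b) ∂α = 0) ∧
      (∀ k, 0 < k → k < n → ∀ [MeasurableSpace (blockNilpotent n k (v₂.adicCompletion K))]
        [BorelSpace (blockNilpotent n k (v₂.adicCompletion K))]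
        (α : Measure (blockNilpotent n k (v₂.adicCompletion K))) [α.IsAddHaarMeasure]
        (a b : GL (Fin n) (v₂.adicCompletion K)),
        ∫ Y, ξ₂ (a * unipotentOfBlock n k (v₂.adicCompletion K) (Multiplicative.ofAdd Y) * b) ∂α = 0) ∧
      ∃ N ∈ 𝓝 (1 : (AdelicGroupData.gl n K).Adelic),
        ∀ (θ : (AdelicGroupData.gl n K).Adelic → ℝ) (hθ : Continuous θ) (hθs : HasCompactSupport θ),
          0 ≤ θ → 0 < θ 1 → Function.support θ ⊆ N →
          ∃ y : W.toSubmodule,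
            ((AdelicGroupData.gl n K).rightRegular μ).integratedOperator
              ((AdelicGroupData.gl n K).isUnitary_rightRegular μ)
              ((AdelicGroupData.gl n K).isStronglyContinuous_rightRegular_holds μ) (adelicHaar n K)
              (localTestFunction₂Cc h hθ hθs ξ₁.continuous ξ₁.hasCompactSupport ξ₂.continuous
                ξ₂.hasCompactSupport)
              ((y : W.toSubmodule) : (AdelicGroupData.gl n K).L2 μ) ≠ 0 := by
  classical
  obtain ⟨F₁, hF₁0, hF₁⟩ := hW₁
  obtain ⟨F₂, hF₂0, hF₂⟩ := hW₂
  have hF₁' : ∀ (a : GL (Fin n) (v₁.adicCompletion K)) (x : V₁),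
      F₁ (ρ₁ a x) = W.toContRep (GLn.toAdelic n K v₁ a) (F₁ x) := hF₁
  have hF₂' : ∀ (a : GL (Fin n) (v₂.adicCompletion K)) (x : V₂),
      F₂ (ρ₂ a x) = W.toContRep (GLn.toAdelic n K v₂ a) (F₂ x) := hF₂
  have hcW : W.toContRep.IsStronglyContinuous := isStronglyContinuous_toContRep W
  have huW : W.toContRep.IsUnitary :=
    ((AdelicGroupData.gl n K).isUnitary_rightRegular μ).toContRep W
  -- Step 1: a vector of `F₁` and a level `U_m` at `v₂` such that `P_{ι₂(U_m)} (F₁ x₁) ≠ 0`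
  obtain ⟨x₁, hx₁⟩ : ∃ x, F₁ x ≠ 0 := by
    by_contra hh
    push Not at hh
    exact hF₁0 (LinearMap.ext hh)
  obtain ⟨m, hm⟩ := exists_norm_vectorAverage_localCongruenceSubgroup_sub_lt W (v := v₂) (F₁ x₁)
    (norm_pos_iff.2 hx₁)
  have hUmc : IsCompact ((localCongruenceSubgroup n K v₂ m : Subgroup (GL (Fin n) (v₂.adicCompletion K))) :
      Set (GL (Fin n) (v₂.adicCompletion K))) := isCompact_localCongruenceSubgroup n K v₂ m
  have hUmo : IsOpen ((localCongruenceSubgroup n K v₂ m : Subgroup (GL (Fin n) (v₂.adicCompletion K))) :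
      Set (GL (Fin n) (v₂.adicCompletion K))) := isOpen_localCongruenceSubgroup n K v₂ m
  set Um : Subgroup (GL (Fin n) (v₂.adicCompletion K)) := localCongruenceSubgroup n K v₂ m with hUm
  set Cm : Subgroup (AdelicGroupData.gl n K).Adelic := Um.map (GLn.toAdelic n K v₂) with hCm
  have hCmc : IsCompact (Cm : Set (AdelicGroupData.gl n K).Adelic) := isCompact_map_toAdelic hUmc
  -- the averaged local component `F° = P_{ι₂(U_m)} ∘ F₁`
  let Fo : V₁ →ₗ[ℂ] W.toSubmodule :=
    { toFun := fun x => W.toContRep.vectorAverage Cm hCmc (F₁ x)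
      map_add' := fun a b => by
        simp only [map_add]
        exact ContRepresentation.vectorAverage_add hcW _ _
      map_smul' := fun c a => by
        simp only [map_smul, RingHom.id_apply]
        exact ContRepresentation.vectorAverage_smul _ _ }
  have hFo_apply : ∀ x, Fo x = W.toContRep.vectorAverage Cm hCmc (F₁ x) := fun x => rfl
  have hFone : Fo x₁ ≠ 0 := by
    intro h0
    have h1 : ‖W.toContRep.vectorAverage Cm hCmc (F₁ x₁) - F₁ x₁‖ < ‖F₁ x₁‖ := hm
    rw [← hFo_apply, h0, zero_sub, norm_neg] at h1
    exact lt_irrefl _ h1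
  have hFo0 : Fo ≠ 0 := fun h0 => hFone (by rw [h0, LinearMap.zero_apply])
  have hFo : ∀ (a : GL (Fin n) (v₁.adicCompletion K)) (x : V₁),
      Fo (ρ₁ a x) = W.toContRep (GLn.toAdelic n K v₁ a) (Fo x) := by
    intro a x
    rw [hFo_apply, hFo_apply, hF₁']
    exact (toContRep_toAdelic_vectorAverage_of_ne W h hUmc a (F₁ x)).symm
  have hFofix : ∀ (x : V₁), ∀ c ∈ Cm, W.toContRep c (Fo x) = Fo x := fun x c hc =>
    ContRepresentation.apply_vectorAverage hcW hc (F₁ x)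
  have hFoi : Function.Injective Fo := injective_of_isIrreducible_of_intertwines_toAdelic W hρ₁ hFo0 hFo
  -- Step 2: a supercusp form at `v₁` and the vector `z = F° x₁`
  have hx₁0 : x₁ ≠ 0 := fun h0 => hx₁ (by rw [h0, map_zero])
  obtain ⟨mGL₁, bGL₁, μ₁, hμ₁⟩ := exists_haarMeasure_glLocal (n := n) (K := K) v₁
  obtain ⟨ut₁, -, ξ₁, hξ₁0, hne₁, U₁, hU₁o, hU₁c, hU₁fix, hξU₁⟩ :=
    exists_supercuspTestFunction_invariant ρ₁ hn hρ₁s hρ₁c hx₁0 μ₁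
  have hU₁x : U₁ ≤ ρ₁.stabilizerSubgroup x₁ := fun u hu =>
    (ρ₁.mem_stabilizerSubgroup x₁ u).2 (hU₁fix u hu)
  set z : W.toSubmodule := Fo x₁ with hz
  have hz₁ : z ∈ W.fixedVectors (U₁.map (GLn.toAdelic n K v₁)) :=
    apply_mem_fixedVectors_map_of_le_stabilizer hFo hU₁x
  obtain ⟨T₁, hT₁⟩ := exists_finset_tsupport_subset_biUnion_coset U₁ hU₁o ξ₁.hasCompactSupport
  -- `y = Σ ξ₁(γ̃₁) R(ι₁ γ̃₁) z = F°(h₁) ≠ 0`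
  set h₁ : V₁ := ∑ γ ∈ T₁, ξ₁ γ.out • ρ₁ γ.out x₁ with hh₁
  have hS₁ : ∑ γ ∈ T₁, ξ₁ γ.out • W.toContRep (GLn.toAdelic n K v₁ γ.out) z = Fo h₁ := by
    rw [hh₁, _root_.map_sum]
    refine Finset.sum_congr rfl fun γ _ => ?_
    rw [map_smul, hFo]
  have hsum : ∫ g, ξ₁ g * ut₁ (ρ₁ g x₁) ∂μ₁ =
      (μ₁.real (U₁ : Set (GL (Fin n) (v₁.adicCompletion K))) : ℂ) * ut₁ h₁ := by
    have hFinv : ∀ g : GL (Fin n) (v₁.adicCompletion K), ∀ u ∈ U₁,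
        ut₁ (ρ₁ (g * u) x₁) = ut₁ (ρ₁ g x₁) := fun g u hu => by
      rw [map_mul, Module.End.mul_apply, hU₁fix u hu]
    have h1 := integral_smul_eq_sum_setIntegral_smul (E := ℂ) (μ := μ₁)
      (F := fun g => ut₁ (ρ₁ g x₁)) (φ := (ξ₁ : GL (Fin n) (v₁.adicCompletion K) → ℂ))
      hU₁o hFinv ξ₁.continuous ξ₁.hasCompactSupport hT₁
    simp only [smul_eq_mul] at h1
    rw [h1, hh₁, _root_.map_sum, Finset.mul_sum]
    refine Finset.sum_congr rfl fun γ _ => ?_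
    rw [setIntegral_setOf_mk_eq_of_right_invariant hU₁o hξU₁ μ₁ γ, map_smul, smul_eq_mul, mul_assoc]
  have huth : ut₁ h₁ ≠ 0 := fun h0 => hne₁ (by rw [hsum, h0, mul_zero])
  have hh0 : h₁ ≠ 0 := fun h0 => huth (by rw [h0, map_zero])
  have hy0 : Fo h₁ ≠ 0 := fun h0 => hh0 (hFoi (by rw [h0, map_zero]))
  have hyfix : ∀ c ∈ Cm, W.toContRep c (Fo h₁) = Fo h₁ := hFofix h₁
  -- Step 3: pair `y` with a translate of the local component at `v₂`
  obtain ⟨g, x₂, hg, hinner⟩ := exists_inner_translate_localComponent_ne_zero hirr hF₂' hF₂0 hy0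
  let F₂' : V₂ →ₗ[ℂ] W.toSubmodule :=
    ((W.toContRep g : W.toSubmodule →L[ℂ] W.toSubmodule) : W.toSubmodule →ₗ[ℂ] W.toSubmodule).comp F₂
  have hF₂'apply : ∀ x, F₂' x = W.toContRep g (F₂ x) := fun x => rfl
  have hF₂'int : ∀ (a : GL (Fin n) (v₂.adicCompletion K)) (x : V₂),
      F₂' (ρ₂ a x) = W.toContRep (GLn.toAdelic n K v₂ a) (F₂' x) := fun a x => by
    rw [hF₂'apply, hF₂'apply]
    exact translate_localComponent_intertwines hF₂' hg a x
  let ut₂ : Module.Dual ℂ V₂ :=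
    ((innerSL ℂ (Fo h₁) : W.toSubmodule →L[ℂ] ℂ) : W.toSubmodule →ₗ[ℂ] ℂ).comp F₂'
  have hut₂apply : ∀ x, ut₂ x = ⟪Fo h₁, F₂' x⟫_ℂ := fun x => rfl
  have hut₂x₂ : ut₂ x₂ ≠ 0 := by
    rw [hut₂apply, hF₂'apply]
    exact hinner
  have hut₂fix : ∀ u ∈ Um, ∀ x : V₂, ut₂ (ρ₂ u x) = ut₂ x := by
    intro u hu x
    rw [hut₂apply, hut₂apply, hF₂'int]
    conv_lhs => rw [← hyfix (GLn.toAdelic n K v₂ u) ⟨u, hu, rfl⟩]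
    exact huW.inner_map_map _ _ _
  have hut₂smooth : ut₂ ∈ ρ₂.contragredient := by
    rw [Representation.mem_contragredient]
    change IsOpen ((ρ₂.dual.stabilizerSubgroup ut₂ : Subgroup (GL (Fin n) (v₂.adicCompletion K))) :
      Set (GL (Fin n) (v₂.adicCompletion K)))
    refine Subgroup.isOpen_mono (H₁ := Um) (fun u hu => ?_) hUmo
    rw [Representation.mem_stabilizerSubgroup, Representation.dual_apply]
    refine LinearMap.ext fun x => ?_
    rw [Module.Dual.transpose_apply, LinearMap.comp_apply]
    exact hut₂fix u⁻¹ (Um.inv_mem hu) x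
  -- Step 4: a supercusp form at `v₂` from `ũ₂`, and `ξ₂ = ξ₀^*`
  obtain ⟨mGL₂, bGL₂, μ₂, hμ₂⟩ := exists_haarMeasure_glLocal (n := n) (K := K) v₂
  obtain ⟨ξ₀, hξ₀0, -, -, ⟨U', hU'o, hU'c, hU'fix, hξ₀U'⟩, hreal, hone⟩ :=
    exists_supercuspTestFunction_of_mem_contragredient_left ρ₂ hn hρ₂s hρ₂c hut₂smooth hut₂x₂ μ₂
  have hξ₂c : Continuous (mulStar (ξ₀ : GL (Fin n) (v₂.adicCompletion K) → ℂ)) :=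
    continuous_mulStar ξ₀.continuous
  have hξ₂s : HasCompactSupport (mulStar (ξ₀ : GL (Fin n) (v₂.adicCompletion K) → ℂ)) :=
    hasCompactSupport_mulStar ξ₀.hasCompactSupport
  let ξ₂ : C_c(GL (Fin n) (v₂.adicCompletion K), ℂ) := ⟨⟨mulStar ξ₀, hξ₂c⟩, hξ₂s⟩
  have hξ₂apply : ∀ a, ξ₂ a = conj (ξ₀ a⁻¹) := fun a => rfl
  set U₂ : Subgroup (GL (Fin n) (v₂.adicCompletion K)) := U' ⊓ Um with hU₂
  have hU₂ : IsCompact (U₂ : Set (GL (Fin n) (v₂.adicCompletion K))) ∧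
      IsOpen (U₂ : Set (GL (Fin n) (v₂.adicCompletion K))) :=
    isCompact_isOpen_inf ⟨hU'c, hU'o⟩ ⟨hUmc, hUmo⟩
  have hξU₂ : ∀ (a : GL (Fin n) (v₂.adicCompletion K)), ∀ u ∈ U₂, ξ₂ (a * u) = ξ₂ a := by
    intro a u hu
    rw [hξ₂apply, hξ₂apply, mul_inv_rev, hξ₀U' _ u⁻¹ (U'.inv_mem hu.1)]
  have hz₂ : z ∈ W.fixedVectors (U₂.map (GLn.toAdelic n K v₂)) := by
    rw [ContRepresentation.ClosedSubrep.mem_fixedVectors]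
    rintro _ ⟨u, hu, rfl⟩
    exact hFofix x₁ _ ⟨u, hu.2, rfl⟩
  obtain ⟨T₂, hT₂⟩ := exists_finset_tsupport_subset_biUnion_coset U₂ hU₂.2 hξ₂s
  -- Step 5: the double Hecke sum is non-zero
  have hcomm : ∀ (a : GL (Fin n) (v₁.adicCompletion K)) (b : GL (Fin n) (v₂.adicCompletion K))
      (w : W.toSubmodule), W.toContRep (GLn.toAdelic n K v₁ a) (W.toContRep (GLn.toAdelic n K v₂ b) w) =
        W.toContRep (GLn.toAdelic n K v₂ b) (W.toContRep (GLn.toAdelic n K v₁ a) w) := by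
    intro a b w
    have hc : W.toContRep (GLn.toAdelic n K v₁ a) * W.toContRep (GLn.toAdelic n K v₂ b) =
        W.toContRep (GLn.toAdelic n K v₂ b) * W.toContRep (GLn.toAdelic n K v₁ a) := by
      rw [← map_mul, ← map_mul, GLn.toAdelic_comm_of_ne h]
    exact congrArg (fun T : W.toSubmodule →L[ℂ] W.toSubmodule => T w) hc
  have hMeq : ∑ γ₂ ∈ T₂, ∑ γ₁ ∈ T₁, (ξ₂ γ₂.out * ξ₁ γ₁.out) •
      W.toContRep (GLn.toAdelic n K v₁ γ₁.out) (W.toContRep (GLn.toAdelic n K v₂ γ₂.out) z) =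
      ∑ γ₂ ∈ T₂, ξ₂ γ₂.out • W.toContRep (GLn.toAdelic n K v₂ γ₂.out) (Fo h₁) := by
    refine Finset.sum_congr rfl fun γ₂ _ => ?_
    rw [← hS₁, _root_.map_sum, Finset.smul_sum]
    refine Finset.sum_congr rfl fun γ₁ _ => ?_
    rw [map_smul, mul_smul, hcomm]
  -- the pairing with `t = F₂' x₂`: `⟪Σ ξ₂(γ̃) R(ι₂ γ̃) y, t⟫ = Σ ξ₀(γ̃⁻¹) ũ₂(ρ₂(γ̃⁻¹) x₂)`
  have hterm : ∀ γ : GL (Fin n) (v₂.adicCompletion K) ⧸ U₂,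
      ⟪ξ₂ γ.out • W.toContRep (GLn.toAdelic n K v₂ γ.out) (Fo h₁), F₂' x₂⟫_ℂ =
        ξ₀ γ.out⁻¹ * ut₂ (ρ₂ γ.out⁻¹ x₂) := by
    intro γ
    have hsm := inner_smul_left (𝕜 := ℂ) (W.toContRep (GLn.toAdelic n K v₂ γ.out) (Fo h₁)) (F₂' x₂)
      (ξ₂ γ.out)
    have hc : W.toContRep (GLn.toAdelic n K v₂ γ.out) * W.toContRep (GLn.toAdelic n K v₂ γ.out⁻¹) = 1 := by
      rw [← map_mul, ← map_mul, mul_inv_cancel, map_one, map_one]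
    have ht : F₂' x₂ = W.toContRep (GLn.toAdelic n K v₂ γ.out)
        (W.toContRep (GLn.toAdelic n K v₂ γ.out⁻¹) (F₂' x₂)) :=
      (congrArg (fun T : W.toSubmodule →L[ℂ] W.toSubmodule => T (F₂' x₂)) hc).symm
    have hin : ⟪W.toContRep (GLn.toAdelic n K v₂ γ.out) (Fo h₁), F₂' x₂⟫_ℂ =
        ut₂ (ρ₂ γ.out⁻¹ x₂) := by
      rw [hut₂apply, hF₂'int]
      conv_lhs => rw [ht]
      exact huW.inner_map_map _ _ _
    rw [hsm, hin, hξ₂apply, Complex.conj_conj]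
  -- the summands are non-negative reals and the one at the coset of `1` is positive
  set φ : GL (Fin n) (v₂.adicCompletion K) → ℂ := fun a => ξ₀ a⁻¹ * ut₂ (ρ₂ a⁻¹ x₂) with hφ
  have hφinv : ∀ (a : GL (Fin n) (v₂.adicCompletion K)), ∀ u ∈ U₂, φ (a * u) = φ a := by
    intro a u hu
    simp only [hφ, mul_inv_rev]
    rw [hξ₀U' _ u⁻¹ (U'.inv_mem hu.1), map_mul, Module.End.mul_apply, hU'fix u⁻¹ (U'.inv_mem hu.1)]
  have h1supp : (1 : GL (Fin n) (v₂.adicCompletion K)) ∈ tsupport (ξ₂ : GL (Fin n) (v₂.adicCompletion K) → ℂ) := by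
    refine subset_tsupport _ (Function.mem_support.2 ?_)
    rw [hξ₂apply, inv_one, map_ne_zero_iff _ (RingHom.injective _)]
    intro h0
    have h1 := hone
    rw [h0, zero_mul, Complex.zero_re] at h1
    exact lt_irrefl _ h1
  obtain ⟨γ₀, hγ₀T, hγ₀⟩ : ∃ γ₀ ∈ T₂, ((1 : GL (Fin n) (v₂.adicCompletion K)) :
      GL (Fin n) (v₂.adicCompletion K) ⧸ U₂) = γ₀ := by
    have h1 := hT₂ h1supp
    simp only [Set.mem_iUnion, Set.mem_setOf_eq] at h1
    obtain ⟨γ₀, hγ₀T, hγ₀⟩ := h1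
    exact ⟨γ₀, hγ₀T, hγ₀⟩
  have hφ1 : φ γ₀.out = ξ₀ 1 * ut₂ (ρ₂ 1 x₂) := by
    rw [← apply_eq_apply_out_of_mk_eq U₂ hφinv hγ₀]
    simp only [hφ, inv_one]
  have hpos : ∑ γ₂ ∈ T₂, ∑ γ₁ ∈ T₁, (ξ₂ γ₂.out * ξ₁ γ₁.out) •
      W.toContRep (GLn.toAdelic n K v₁ γ₁.out) (W.toContRep (GLn.toAdelic n K v₂ γ₂.out) z) ≠ 0 := by
    rw [hMeq]
    intro h0
    have h1 := congrArg (fun w : W.toSubmodule => (⟪w, F₂' x₂⟫_ℂ).re) h0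
    have e0 : ⟪(0 : W.toSubmodule), F₂' x₂⟫_ℂ = 0 := inner_zero_left _
    have es := sum_inner (𝕜 := ℂ) T₂
      (fun γ : GL (Fin n) (v₂.adicCompletion K) ⧸ U₂ =>
        ξ₂ γ.out • W.toContRep (GLn.toAdelic n K v₂ γ.out) (Fo h₁)) (F₂' x₂)
    rw [e0, es, Complex.zero_re, Complex.re_sum] at h1
    simp_rw [hterm] at h1
    -- `Σ re = 0` with non-negative terms forces every term to vanish
    have hnn : ∀ γ ∈ T₂, 0 ≤ (ξ₀ γ.out⁻¹ * ut₂ (ρ₂ γ.out⁻¹ x₂)).re := fun γ _ => (hreal _).1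
    have hall := (Finset.sum_eq_zero_iff_of_nonneg hnn).1 h1 γ₀ hγ₀T
    have h2 : (φ γ₀.out).re = 0 := hall
    rw [hφ1] at h2
    rw [h2] at hone
    exact lt_irrefl _ hone
  -- Step 6: the two-place non-vanishing theorem
  obtain ⟨N, hN, hmainθ⟩ := exists_nhds_integratedOperator_localTestFunction₂_ne_zero W h
    ⟨hU₁c, hU₁o⟩ hU₂ ξ₁.continuous ξ₁.hasCompactSupport hξU₁ hξ₂c hξ₂s hξU₂ hT₁ hT₂ hz₁ hz₂ hpos
  refine ⟨ξ₁, ξ₂, hξ₁0, fun k hk hkn _ _ α _ a b => ?_, N, hN,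
    fun θ hθ hθs hθ0 hθ1 hθN => ⟨z, hmainθ θ hθ hθs hθ0 hθ1 hθN⟩⟩
  exact mulStar_supercuspForm (fun β _ a' b' => hξ₀0 k hk hkn β a' b') α a b

/-- The compression `R(Φ)|_Π` is non-zero as soon as `R(Φ) y ≠ 0` for some `y ∈ Π` (the form of the
non-vanishing consumed by `exists_comparisonDatum_of_testAlgebra`). [folklore] -/
theorem integratedOperatorRestrict_ne_zero_of_exists
    (W : ContRepresentation.ClosedSubrep ((AdelicGroupData.gl n K).rightRegular μ))
    (Φ : C_c((AdelicGroupData.gl n K).Adelic, ℂ))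
    (hy : ∃ y : W.toSubmodule,
      ((AdelicGroupData.gl n K).rightRegular μ).integratedOperator
        ((AdelicGroupData.gl n K).isUnitary_rightRegular μ)
        ((AdelicGroupData.gl n K).isStronglyContinuous_rightRegular_holds μ) (adelicHaar n K) Φ
        ((y : W.toSubmodule) : (AdelicGroupData.gl n K).L2 μ) ≠ 0) :
    W.integratedOperatorRestrict ((AdelicGroupData.gl n K).isUnitary_rightRegular μ)
      ((AdelicGroupData.gl n K).isStronglyContinuous_rightRegular_holds μ) (adelicHaar n K) Φ ≠ 0 := by
  obtain ⟨y, hy⟩ := hy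
  intro h0
  apply hy
  have h1 := congrArg (fun T : W.toSubmodule →L[ℂ] W.toSubmodule =>
    ((T y : W.toSubmodule) : (AdelicGroupData.gl n K).L2 μ)) h0
  simpa only [ContRepresentation.ClosedSubrep.coe_integratedOperatorRestrict_apply,
    zero_apply, Submodule.coe_zero] using h1

/-- **Two supercuspidal local components, operator form**: under the hypotheses of
`exists_localTestFunction₂_of_two_supercuspidal_localComponents`, the compression
`R(θ^{(v₁v₂)} ⊗ ξ₁ ⊗ ξ₂)|_Π` is a non-zero operator on `Π` for all small admissible `θ` — the
non-vanishing input `hne` of `exists_comparisonDatum_of_testAlgebra` (`TraceComparisonDatumOfTestAlgebra`)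
for the surjectivity half of the Jacquet–Langlands correspondence. [cite: Gelbart1975, §10 pp. 151–153] -/
theorem exists_localTestFunction₂_integratedOperatorRestrict_ne_zero (hn : 0 < n) (h : v₁ ≠ v₂)
    (W : ContRepresentation.ClosedSubrep ((AdelicGroupData.gl n K).rightRegular μ))
    (hirr : W.toContRep.IsTopIrreducible)
    {V₁ : Type*} [AddCommGroup V₁] [Module ℂ V₁]
    {ρ₁ : Representation ℂ (GL (Fin n) (v₁.adicCompletion K)) V₁}
    (hρ₁ : ρ₁.IsIrreducible) (hρ₁s : ρ₁.IsSmooth) (hρ₁c : ρ₁.IsSupercuspidal)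
    (hW₁ : HasLocalComponentAt W v₁ ρ₁)
    {V₂ : Type*} [AddCommGroup V₂] [Module ℂ V₂]
    {ρ₂ : Representation ℂ (GL (Fin n) (v₂.adicCompletion K)) V₂}
    (hρ₂s : ρ₂.IsSmooth) (hρ₂c : ρ₂.IsSupercuspidal) (hW₂ : HasLocalComponentAt W v₂ ρ₂) :
    ∃ (ξ₁ : C_c(GL (Fin n) (v₁.adicCompletion K), ℂ)) (ξ₂ : C_c(GL (Fin n) (v₂.adicCompletion K), ℂ)),
      (∀ k, 0 < k → k < n → ∀ [MeasurableSpace (blockNilpotent n k (v₁.adicCompletion K))]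
        [BorelSpace (blockNilpotent n k (v₁.adicCompletion K))]
        (α : Measure (blockNilpotent n k (v₁.adicCompletion K))) [α.IsAddHaarMeasure]
        (a b : GL (Fin n) (v₁.adicCompletion K)),
        ∫ Y, ξ₁ (a * unipotentOfBlock n k (v₁.adicCompletion K) (Multiplicative.ofAdd Y) * b) ∂α = 0) ∧
      (∀ k, 0 < k → k < n → ∀ [MeasurableSpace (blockNilpotent n k (v₂.adicCompletion K))]
        [BorelSpace (blockNilpotent n k (v₂.adicCompletion K))]
        (α : Measure (blockNilpotent n k (v₂.adicCompletion K))) [α.IsAddHaarMeasure]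
        (a b : GL (Fin n) (v₂.adicCompletion K)),
        ∫ Y, ξ₂ (a * unipotentOfBlock n k (v₂.adicCompletion K) (Multiplicative.ofAdd Y) * b) ∂α = 0) ∧
      ∃ N ∈ 𝓝 (1 : (AdelicGroupData.gl n K).Adelic),
        ∀ (θ : (AdelicGroupData.gl n K).Adelic → ℝ) (hθ : Continuous θ) (hθs : HasCompactSupport θ),
          0 ≤ θ → 0 < θ 1 → Function.support θ ⊆ N →
          W.integratedOperatorRestrict ((AdelicGroupData.gl n K).isUnitary_rightRegular μ)
            ((AdelicGroupData.gl n K).isStronglyContinuous_rightRegular_holds μ) (adelicHaar n K)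
            (localTestFunction₂Cc h hθ hθs ξ₁.continuous ξ₁.hasCompactSupport ξ₂.continuous
              ξ₂.hasCompactSupport) ≠ 0 := by
  obtain ⟨ξ₁, ξ₂, h1, h2, N, hN, hmain⟩ :=
    exists_localTestFunction₂_of_two_supercuspidal_localComponents hn h W hirr hρ₁ hρ₁s hρ₁c hW₁
      hρ₂s hρ₂c hW₂
  exact ⟨ξ₁, ξ₂, h1, h2, N, hN, fun θ hθ hθs hθ0 hθ1 hθN =>
    integratedOperatorRestrict_ne_zero_of_exists W _ (hmain θ hθ hθs hθ0 hθ1 hθN)⟩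

end Assembly

end Literature.NumberTheory.Automorphic
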